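import Literature.NumberTheory.EllipticCurves.ZpExtensionScalarTwistMaps
import Literature.NumberTheory.EllipticCurves.IwasawaTwistModPShapiroConj
import HarnessLib

/-!
# The finite-level control map `H¹(K_n, M) → H¹(K, M ⊗ A_{m,k}(ψ))` of Howard's specialisation at the
# Eisenstein prime `𝔮 = (T^m + p)`: corestriction after `a ↦ 1 ⊗ a`, the dictionary
# `conj_g ↔ (1+T)^{-κ̄(g)}`, transitivity in the level `n`, naturality in `(k, M)`
# (definitions with bodies + theorems; no named fact, no instance, no notation)

Topic `NumberTheory/EllipticCurves` (companion of `ZpExtensionScalarTwist[Maps]`; the `A_{m,k}`-coefficient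
twin of `IwasawaTwistModPShapiroCores/Conj`, whose corestriction toolkit `cores`, `coresLe`, `cores_conjMap`,
`cohomologyMap_cores[Le]`, `cores_coresLe_eq_cores` is reused). Namespace `….EllipticCurves.ZpExtension`.
`κ : ZpExtension K p` (`Γ_n = κ.layerSubgroup n = Gal(K̄/K_n)`), `ρ` a discrete `Γ_K`-module on `M`, `m ≥ 1`,
`A_{m,k} = Λ/(T^m + p, p^k)` (`IwasawaAlgebra.EisensteinCoeff`), `M ⊗ A_{m,k}(ψ) = κ.eisensteinTwist ρ hm k`
(`σ ↦ (1+T)^{κ(σ) mod p^J} ⊗ ρ(σ)`, `J = eisensteinLevel hm k`); for `M = E[p^k]` this is `T_𝔮/p^k T_𝔮`,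
`𝔮 = (T^m + p)` [Howard 2004, §2.2, proof of Thm. 2.2.10: "taking `𝔮 = T^m + p`"].

* §1 `eisensteinUnitCoeff p m k : M →+ M ⊗ A_{m,k}`, `a ↦ 1 ⊗ a`, `Γ_J`-equivariant (`Γ_J` acts on `1 ⊗ M`
  through `ρ`), so `eisensteinUnitCoeffHom … N hN : M|_N ⟶ (M ⊗ A_{m,k}(ψ))|_N` for every subgroup `N ≤ Γ_J`;
  for any `g ∈ Γ_K`: `(1+T)^a • (g · (1 ⊗ x)) = 1 ⊗ ρ(g) x` when `a ≡ −κ̄_J(g) (mod p^J)`.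
* §2 **`coresEisenstein κ ρ hm k N hN hNo : H¹(N, M) →+ H¹(Γ_K, M ⊗ A_{m,k}(ψ))` `:= cor ∘ H¹(a ↦ 1 ⊗ a)`**
  for an open `N ≤ Γ_J` of finite index — stated for a general subgroup so that `N = Γ_n` may be a layer of `κ`
  OR of a twist `κ.unitTwist u` with the same layers (the D1 road instantiates at `κ.unitTwist (-1)`, see §3) —
  the level-`(n, k)` component of Howard's control map `𝔖 = lim← H¹(K_n, T_p E) = H¹(K, 𝐓) → H¹(K, T_𝔮)`
  (`𝐓 → 𝐓 ⊗_Λ S_𝔮`) [Howard 2004, §2.2, Lemma 2.2.7 / Prop. 2.2.8; Mazur–Rubin 2004, §5.3], i.e. Serre's "Cor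
  through the induced module" [*Galois Cohomology*, I §2.5 (b)]. For `ρ = torsionGaloisModule (p^k)`,
  `N = κ.layerSubgroup n` the source is the tree's `torsionH1Over (p^k) Γ_n` (definitionally, cf.
  `Kato2004.conjH1_torsion_eq_conjMap`) = the `k`-th component of `LambdaAdicSelmerData.proj n`.
* §3 **dictionary `conj_g ↔ (1+T)^{−κ̄_J(g)}`** (`coresEisenstein_conjMap`): for `a ≡ −κ̄_J(g) (mod p^J)`,
  `coresEisenstein (g · c) = H¹((1+T)^a •) (coresEisenstein c)` (`g · c = conjMap`, the tree's `conjH1`, through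
  which `T := conj_γ − 1` acts on `𝔖`, `LambdaAdicSelmerData.proj_X`; `(1+T)^a •` = `eisensteinTwistSMulHom`).
  Corollaries for `κ̄_J(g) = ∓1`: `γ⁻¹ · ↦ (1+T) •`, `γ · ↦ (1+T)^{p^J−1} • = (1+T)^{−1} •`. CONSEQUENCE (cell
  `pub/bsd-print-x9`, D1 road, ruling of its LEAD 2026-08-28): with `ψ(γ) = 1+T` and `T|_𝔖 = conj_γ − 1`,
  `cor ∘ unit ∘ proj_n` intertwines `T` with `ι(T) = (1+T)^{−1} − 1` (`ι` the involution of `Λ`); it is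
  `Λ`-linear on the nose for the twist by `ψ^{−1}`, i.e. for `(κ.unitTwist (-1)).eisensteinTwist`, for which
  `κ̄_J(γ) = −1` — whence the general subgroup `N` in §2 (the layers of `κ.unitTwist (-1)` are those of `κ`).
* §4 **transitivity in `N`**: `coresEisenstein N' = coresEisenstein N ∘ cor_{N' → N}` (`N' ≤ N ≤ Γ_J`), so
  `coresEisenstein Γ_n x_n` is independent of `n` on a corestriction-compatible family `(x_n)_n`.
* §5 **naturality in `(k, M)`**: `H¹(eisensteinTwistReduce f) ∘ coresEisenstein_{k'} = coresEisenstein_k ∘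
  H¹(N, f)` for `k ≤ k'`, `f : M → M'` (for `f = p^{k'−k} : E[p^{k'}] → E[p^k]`: the transition maps of
  `lim←_k H¹(K, T_𝔮/p^k)` and `S_p(E/K_n) = lim←_k H¹(K_n, E[p^k])`).

DEFINITIONS WITH BODIES and theorems; nothing asserted about any curve, Selmer group or `L`-function; no
instance, no notation, no `sorry`. Not here: the Selmer structure `F_𝔮`, the pinned `H = lim←_k H¹_{F_𝔮}`,
control bounds. BSD is not proved by any of this.

References: [Howard2004HeegnerKolyvagin] Compositio Math. 140 (2004), §2.2 (𝐓, T_𝔮, 𝔖 ≅ lim← H¹(K_n, T)),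
Def. 2.2.3, Lemma 2.2.7, Prop. 2.2.8, proof of Thm. 2.2.10; [MazurRubinMemoirs2004] Mem. AMS 799 (2004), §5.3;
[SerreGaloisCohomology1997] I §2.4 (Res, Cor), I §2.5 (Prop. 10, (b), Exercise 1); [NeukirchSchmidtWingberg2008]
I §5, Prop. 1.5.4, (1.6.3)–(1.6.5); [SerreLocalFields1979] VII §5; [Washington1997] §13.1–§13.2 (`T = γ − 1`).
-/

noncomputable section

open scoped TensorProduct Topology ContRepresentation
open Field Filter CategoryTheory

universe u

namespace Literature.NumberTheory.EllipticCurves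

open Literature.NumberTheory.GaloisRepresentations

namespace ZpExtension

variable {K : Type u} [Field K] {p : ℕ} [hp : Fact p.Prime] (κ : ZpExtension K p)
variable {M : Type u} [AddCommGroup M] [TopologicalSpace M] [DiscreteTopology M]
variable (ρ : DiscreteGaloisModule K M) {m : ℕ} (hm : 1 ≤ m) (k : ℕ)

/-! ## §1 `M → M ⊗ A_{m,k}`, `a ↦ 1 ⊗ a`, a `Γ_J`-equivariant map -/

section Unit

variable (p) in
/-- **`M → M ⊗ A_{m,k}`, `a ↦ 1 ⊗ a`** (coefficient `1 ∈ A_{m,k} = Λ/(T^m + p, p^k)`): the map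
`T_p E/p^k → T_𝔮/p^k T_𝔮` induced by `Λ → S_𝔮` on `𝐓 = T_p E ⊗ Λ` at finite level (Shapiro's unit map followed
by `Ind ↠ M ⊗ A_{m,k}(ψ)`). [cite: Howard2004HeegnerKolyvagin, §2.2 (T_𝔮 = 𝐓 ⊗_Λ S_𝔮)] [cite: SerreGaloisCohomology1997, I §2.5] -/
def eisensteinUnitCoeff (m k : ℕ) : M →+ IwasawaAlgebra.EisensteinCoeff.Twisted p m k M where
  toFun a := IwasawaAlgebra.EisensteinCoeff.Twisted.tmul 1 a
  map_zero' := TensorProduct.tmul_zero _ _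
  map_add' _ _ := TensorProduct.tmul_add _ _ _

omit [TopologicalSpace M] [DiscreteTopology M] in
/-- Unfolding `eisensteinUnitCoeff`: `eisensteinUnitCoeff a = 1 ⊗ a`. [cite: Howard2004HeegnerKolyvagin, §2.2] -/
@[simp]
theorem eisensteinUnitCoeff_apply (a : M) :
    eisensteinUnitCoeff p m k a = IwasawaAlgebra.EisensteinCoeff.Twisted.tmul 1 a :=
  rfl

/-- **`g ∈ Γ_K` acts on `1 ⊗ a` by `(1+T)^{κ(g) mod p^J} • (1 ⊗ ρ(g) a)`** (`J = eisensteinLevel hm k`):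
`eisensteinTwist_apply_tmul` on the unit vector. [cite: Howard2004HeegnerKolyvagin, §2.2 (Γ_K acts on Λ through γ ↦ 1 + T)] -/
theorem eisensteinTwist_eisensteinUnitCoeff (g : absoluteGaloisGroup K) (a : M) :
    κ.eisensteinTwist ρ hm k g (eisensteinUnitCoeff p m k a) =
      IwasawaAlgebra.EisensteinCoeff.onePlusT p m k ^ κ.twistExponent (eisensteinLevel (p := p) hm k) g •
        eisensteinUnitCoeff p m k (ρ g a) := by
  rw [eisensteinUnitCoeff_apply, eisensteinUnitCoeff_apply, κ.eisensteinTwist_apply_tmul ρ hm k,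
    IwasawaAlgebra.EisensteinCoeff.Twisted.smul_tmul]

/-- **`Γ_J` acts on `1 ⊗ M` through `ρ`**: `g · (1 ⊗ a) = 1 ⊗ ρ(g) a` for `g ∈ Γ_J = Gal(K̄/K_J)`,
`J = eisensteinLevel hm k`. [cite: Howard2004HeegnerKolyvagin, §2.2] [cite: Washington1997, §13.1–§13.2] -/
theorem eisensteinTwist_eisensteinUnitCoeff_of_mem {g : absoluteGaloisGroup K}
    (hg : g ∈ κ.layerSubgroup (eisensteinLevel (p := p) hm k)) (a : M) :
    κ.eisensteinTwist ρ hm k g (eisensteinUnitCoeff p m k a) = eisensteinUnitCoeff p m k (ρ g a) := by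
  rw [eisensteinTwist_eisensteinUnitCoeff, κ.twistExponent_eq_zero_of_mem_layerSubgroup hg, pow_zero, one_smul]

/-- **`(1+T)^a • (g · (1 ⊗ x)) = 1 ⊗ ρ(g) x` when `a ≡ −κ̄_J(g) (mod p^J)`** (`(1+T)^{p^J} = 1` in `A_{m,k}`).
[cite: Washington1997, §13.1–§13.2] [cite: Howard2004HeegnerKolyvagin, §2.2] -/
theorem smul_eisensteinTwist_eisensteinUnitCoeff (g : absoluteGaloisGroup K) {a : ℕ}
    (ha : (a : ZMod (p ^ eisensteinLevel (p := p) hm k)) = -κ.layerIndex (eisensteinLevel (p := p) hm k) g)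
    (x : M) :
    IwasawaAlgebra.EisensteinCoeff.onePlusT p m k ^ a • κ.eisensteinTwist ρ hm k g (eisensteinUnitCoeff p m k x) =
      eisensteinUnitCoeff p m k (ρ g x) := by
  rw [eisensteinTwist_eisensteinUnitCoeff, smul_smul, ← pow_add]
  have hdvd : p ^ eisensteinLevel (p := p) hm k ∣ a + κ.twistExponent (eisensteinLevel (p := p) hm k) g := by
    rw [← ZMod.natCast_eq_zero_iff, Nat.cast_add, ha,
      κ.natCast_twistExponent (eisensteinLevel (p := p) hm k) (eisensteinLevel (p := p) hm k) le_rfl,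
      neg_add_cancel]
  obtain ⟨q, hq⟩ := hdvd
  rw [hq, pow_mul, onePlusT_pow_prime_pow_eisensteinLevel, one_pow, one_smul]

variable (N : Subgroup (absoluteGaloisGroup K)) (hN : N ≤ κ.layerSubgroup (eisensteinLevel (p := p) hm k))

/-- **`a ↦ 1 ⊗ a` as a morphism `M|_N ⟶ (M ⊗ A_{m,k}(ψ))|_N`** of topological representations of a subgroup
`N ≤ Γ_J = Gal(K̄/K_J)`, `J = eisensteinLevel hm k` (`Γ_J` acts on `1 ⊗ M` through `ρ`); intended `N = Γ_n`,
`n ≥ J`, a layer of `κ` or of any `ℤ_p`-extension with the same layers (e.g. `κ.unitTwist u`).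
[cite: SerreGaloisCohomology1997, I §2.5] [cite: Howard2004HeegnerKolyvagin, §2.2] -/
def eisensteinUnitCoeffHom :
    subgroupRep ρ.toTopRep N ⟶ subgroupRep (κ.eisensteinTwist ρ hm k).toTopRep N :=
  TopRep.ofHom
    ⟨{ toFun := eisensteinUnitCoeff p m k
       map_add' := map_add _
       map_smul' := fun c a ↦ by simp only [map_zsmul, RingHom.id_apply]
       cont := continuous_of_discreteTopology },
      fun g ↦ ContinuousLinearMap.ext fun a ↦
        (κ.eisensteinTwist_eisensteinUnitCoeff_of_mem ρ hm k (hN g.2) a).symm⟩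

/-- `eisensteinUnitCoeffHom` is `a ↦ 1 ⊗ a` on elements. [cite: SerreGaloisCohomology1997, I §2.5] -/
@[simp]
theorem eisensteinUnitCoeffHom_hom_apply (a : M) :
    (κ.eisensteinUnitCoeffHom ρ hm k N hN).hom a = eisensteinUnitCoeff p m k a :=
  rfl

end Unit

/-! ## §2 The finite-level control map `coresEisenstein N = cor_N^{Γ_K} ∘ H¹(a ↦ 1 ⊗ a)` -/

section Cores

variable (N : Subgroup (absoluteGaloisGroup K)) (hN : N ≤ κ.layerSubgroup (eisensteinLevel (p := p) hm k))
  (hNo : IsOpen (N : Set (absoluteGaloisGroup K)))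

/-- **`coresEisenstein N : H¹(N, M) →+ H¹(Γ_K, M ⊗ A_{m,k}(ψ))`, `c ↦ cor_N^{Γ_K}(H¹(a ↦ 1 ⊗ a)(c))`** for an
open subgroup `N ≤ Γ_J` of finite index (`J = eisensteinLevel hm k`; intended `N = Γ_n = Gal(K̄/K_n)`, `n ≥ J`):
the level-`(n, k)` component of Howard's control map `𝔖 = lim←_n H¹(K_n, T_p E) = H¹(K, 𝐓) → H¹(K, T_𝔮)`,
`T_𝔮 = 𝐓 ⊗_Λ S_𝔮`, `𝔮 = (T^m + p)` (for `M = E[p^k]` the target is `H¹(K, T_𝔮/p^k T_𝔮)`), as "corestriction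
after `M → M ⊗ A_{m,k}(ψ)`" (Serre's Cor through the induced module; the tree's transfer `cores`).
`Fintype (Γ_K ⧸ N)` is an instance binder (for `N = Γ_n`: e.g. `κ.fintypeQuotientLayer n`).
[cite: Howard2004HeegnerKolyvagin, §2.2, Lemma 2.2.7 and Prop. 2.2.8 (the map 𝔖 → H¹(K, T_𝔮))]
[cite: SerreGaloisCohomology1997, I §2.5 Prop. 10 and (b)] [cite: MazurRubinMemoirs2004, §5.3] -/
def coresEisenstein [Fintype (absoluteGaloisGroup K ⧸ N)] :
    continuousCohomology 1 (subgroupRep ρ.toTopRep N) →+ galoisCohomology (κ.eisensteinTwist ρ hm k) 1 :=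
  (cores (κ.eisensteinTwist ρ hm k).toTopRep N hNo).toAddMonoidHom.comp
    (cohomologyMap (κ.eisensteinUnitCoeffHom ρ hm k N hN) 1).hom.toLinearMap.toAddMonoidHom

/-- Unfolding `coresEisenstein`: `cores ∘ H¹(eisensteinUnitCoeffHom)`. [cite: SerreGaloisCohomology1997, I §2.5] -/
theorem coresEisenstein_apply [Fintype (absoluteGaloisGroup K ⧸ N)]
    (c : continuousCohomology 1 (subgroupRep ρ.toTopRep N)) :
    κ.coresEisenstein ρ hm k N hN hNo c = cores (κ.eisensteinTwist ρ hm k).toTopRep N hNo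
      (cohomologyMap (κ.eisensteinUnitCoeffHom ρ hm k N hN) 1 c) :=
  rfl

/-- `coresEisenstein` on explicit cocycles: the class of the transfer of `u ↦ 1 ⊗ φ(u)`, for any system
`s` of representatives of `Γ_K ⧸ N`. [cite: SerreGaloisCohomology1997, I §2.5]
[cite: NeukirchSchmidtWingberg2008, I §5] -/
theorem coresEisenstein_oneCocycleClass [Fintype (absoluteGaloisGroup K ⧸ N)]
    {s : absoluteGaloisGroup K ⧸ N → absoluteGaloisGroup K} (hs : ∀ x, (s x : absoluteGaloisGroup K ⧸ N) = x)
    (φ : contOneCocycles (subgroupRep ρ.toTopRep N)) :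
    κ.coresEisenstein ρ hm k N hN hNo (oneCocycleClass _ φ) =
      oneCocycleClass (κ.eisensteinTwist ρ hm k).toTopRep
        (transferCocycle (κ.eisensteinTwist ρ hm k).toTopRep N hNo hs
          (contOneCocycles.pullback (ContinuousMonoidHom.id _)
            (resIdHom (κ.eisensteinUnitCoeffHom ρ hm k N hN)) φ)) := by
  rw [coresEisenstein_apply, cohomologyMap_oneCocycleClass, cores_oneCocycleClass _ _ _ hs]

end Cores

/-! ## §3 The dictionary `conj_g ↔ (1+T)^{−κ̄_J(g)}` -/

section ConjDictionary

variable (N : Subgroup (absoluteGaloisGroup K)) [N.Normal] (hN : N ≤ κ.layerSubgroup (eisensteinLevel (p := p) hm k))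
  (hNo : IsOpen (N : Set (absoluteGaloisGroup K))) [Fintype (absoluteGaloisGroup K ⧸ N)]

/-- **The dictionary `conj_g ↔ (1+T)^{−κ̄_J(g)}` on `H¹`.** For `g ∈ Γ_K`, `c ∈ H¹(N, M)` (`N ⊴ Γ_K` open of finite index,
`N ≤ Γ_J`, e.g. `N = Γ_n`) and `a ≡ −κ̄_J(g) (mod p^J)`: `coresEisenstein N (g · c) = H¹((1+T)^a •)
(coresEisenstein N c)`, where `g · c = conjMap ρ N g 1 c` is the conjugation action on `H¹(K_n, M)` (through
which `T = γ − 1` acts on `𝔖 = lim← H¹(K_n, ·)`) and `(1+T)^a •` is the Galois endomorphism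
`eisensteinTwistSMulHom`. On cocycles `1 ⊗ (g·φ) = (1+T)^a • (g · (1 ⊗ φ))`; then `cor` commutes with
`(1+T)^a •` (`cohomologyMap_cores`) and `cor (g · y) = cor y` (`cores_conjMap`) — Serre's "the `G/H`-action on
`M_G^H(A)` induces the natural action on `H^q(H, A)`", `g` acting on `Ind ↠ M ⊗ A_{m,k}(ψ)` by `(1+T)^{−κ̄(g)}`.
[cite: SerreGaloisCohomology1997, I §2.5 (b) and Exercise 1] [cite: NeukirchSchmidtWingberg2008, Prop. 1.5.4]
[cite: Howard2004HeegnerKolyvagin, §2.2 (𝔖 = H¹(K, 𝐓) as a Λ-module)] -/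
theorem coresEisenstein_conjMap (g : absoluteGaloisGroup K) {a : ℕ}
    (ha : (a : ZMod (p ^ eisensteinLevel (p := p) hm k)) = -κ.layerIndex (eisensteinLevel (p := p) hm k) g)
    (c : continuousCohomology 1 (subgroupRep ρ.toTopRep N)) :
    κ.coresEisenstein ρ hm k N hN hNo (conjMap ρ.toTopRep N g 1 c) =
      galoisCohomology.map
        (κ.eisensteinTwistSMulHom ρ hm k (IwasawaAlgebra.EisensteinCoeff.onePlusT p m k ^ a)) 1
        (κ.coresEisenstein ρ hm k N hN hNo c) := by
  classical
  obtain ⟨φ, rfl⟩ := oneCocycleClass_surjective _ c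
  set F : (κ.eisensteinTwist ρ hm k).toTopRep ⟶ (κ.eisensteinTwist ρ hm k).toTopRep :=
    TopRep.ofHom
      ⟨(κ.eisensteinTwistSMulHom ρ hm k (IwasawaAlgebra.EisensteinCoeff.onePlusT p m k ^ a)).toContinuousLinearMap,
        (κ.eisensteinTwistSMulHom ρ hm k
          (IwasawaAlgebra.EisensteinCoeff.onePlusT p m k ^ a)).isIntertwining'⟩ with hF
  -- cocycle identity: `1 ⊗ (g·φ) = (1+T)^a • (g · (1 ⊗ φ))`
  have hcocycle :
      contOneCocycles.pullback (ContinuousMonoidHom.id _) (resIdHom (κ.eisensteinUnitCoeffHom ρ hm k N hN))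
          (contOneCocycles.pullback (subgroupConj N g)
            (conjRepHom ρ.toTopRep N g) φ) =
        contOneCocycles.pullback (ContinuousMonoidHom.id _)
          (resIdHom (subgroupRepHom F N))
          (contOneCocycles.pullback (subgroupConj N g)
            (conjRepHom (κ.eisensteinTwist ρ hm k).toTopRep N g)
            (contOneCocycles.pullback (ContinuousMonoidHom.id _)
              (resIdHom (κ.eisensteinUnitCoeffHom ρ hm k N hN)) φ)) := by
    refine Subtype.ext (ContinuousMap.ext fun x ↦ ?_)
    rw [pullback_id_resIdHom_apply, conj_pullback_apply, pullback_id_resIdHom_apply,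
      conj_pullback_apply, pullback_id_resIdHom_apply, eisensteinUnitCoeffHom_hom_apply,
      eisensteinUnitCoeffHom_hom_apply, subgroupRepHom_hom_apply, ContinuousRep.toTopRep_ρ_apply,
      ContinuousRep.toTopRep_ρ_apply]
    exact (κ.smul_eisensteinTwist_eisensteinUnitCoeff ρ hm k g ha _).symm
  rw [conjMap_oneCocycleClass]
  change cores _ _ _ (cohomologyMap (κ.eisensteinUnitCoeffHom ρ hm k N hN) 1 (oneCocycleClass _ _)) =
    cohomologyMap F 1 (cores _ _ _ (cohomologyMap (κ.eisensteinUnitCoeffHom ρ hm k N hN) 1 (oneCocycleClass _ φ)))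
  conv_lhs => rw [cohomologyMap_oneCocycleClass, hcocycle, ← cohomologyMap_oneCocycleClass,
    ← conjMap_oneCocycleClass, ← cohomologyMap_oneCocycleClass]
  rw [← cohomologyMap_cores, cores_conjMap]

/-- **`Γ_J` acts trivially after `coresEisenstein`**: `coresEisenstein n (g · c) = coresEisenstein n c` for
`g ∈ Γ_J` (the case `a = 0`). [cite: SerreLocalFields1979, VII.§5 Prop. 3] [cite: SerreGaloisCohomology1997, I §2.5 (b)] -/
theorem coresEisenstein_conjMap_of_mem {g : absoluteGaloisGroup K}
    (hg : g ∈ κ.layerSubgroup (eisensteinLevel (p := p) hm k))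
    (c : continuousCohomology 1 (subgroupRep ρ.toTopRep N)) :
    κ.coresEisenstein ρ hm k N hN hNo (conjMap ρ.toTopRep N g 1 c) =
      κ.coresEisenstein ρ hm k N hN hNo c := by
  have ha : ((0 : ℕ) : ZMod (p ^ eisensteinLevel (p := p) hm k)) =
      -κ.layerIndex (eisensteinLevel (p := p) hm k) g := by
    rw [Nat.cast_zero, (κ.layerIndex_eq_zero_iff _ g).2 hg, neg_zero]
  rw [κ.coresEisenstein_conjMap ρ hm k N hN hNo g ha c, pow_zero]
  obtain ⟨ψ, hψ⟩ := oneCocycleClass_surjective _ (κ.coresEisenstein ρ hm k N hN hNo c)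
  rw [← hψ]
  change cohomologyMap (TopRep.ofHom ⟨(κ.eisensteinTwistSMulHom ρ hm k 1).toContinuousLinearMap,
      (κ.eisensteinTwistSMulHom ρ hm k 1).isIntertwining'⟩) 1 (oneCocycleClass _ ψ) = oneCocycleClass _ ψ
  rw [cohomologyMap_oneCocycleClass]
  refine congrArg _ (Subtype.ext (ContinuousMap.ext fun x ↦ ?_))
  rw [pullback_id_resIdHom_apply]
  change (1 : IwasawaAlgebra.EisensteinCoeff p m k) • ψ.1 x = ψ.1 x
  exact one_smul _ _

/-- **`κ̄_J(g) = −1` ⇒ `coresEisenstein n (g · c) = (1+T) • coresEisenstein n c`** (`a = 1`; e.g. `g = γ⁻¹`):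
with `T|_𝔖 := conj_γ − 1` (`LambdaAdicSelmerData.proj_X`) the control map is `Λ`-LINEAR for the twist by `ψ⁻¹`
(`eisensteinTwist` of the inverse `ℤ_p`-extension, same layers).
[cite: SerreGaloisCohomology1997, I §2.5 (b) and Exercise 1] [cite: Washington1997, §13.1–§13.2] -/
theorem coresEisenstein_conjMap_of_layerIndex_eq_neg_one {g : absoluteGaloisGroup K}
    (hg : κ.layerIndex (eisensteinLevel (p := p) hm k) g = -1)
    (c : continuousCohomology 1 (subgroupRep ρ.toTopRep N)) :
    κ.coresEisenstein ρ hm k N hN hNo (conjMap ρ.toTopRep N g 1 c) =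
      galoisCohomology.map
        (κ.eisensteinTwistSMulHom ρ hm k (IwasawaAlgebra.EisensteinCoeff.onePlusT p m k)) 1
        (κ.coresEisenstein ρ hm k N hN hNo c) := by
  have ha : ((1 : ℕ) : ZMod (p ^ eisensteinLevel (p := p) hm k)) =
      -κ.layerIndex (eisensteinLevel (p := p) hm k) g := by
    rw [Nat.cast_one, hg, neg_neg]
  rw [κ.coresEisenstein_conjMap ρ hm k N hN hNo g ha c, pow_one]

/-- **`κ̄_J(g) = 1` ⇒ `coresEisenstein n (g · c) = (1+T)^{p^J − 1} • coresEisenstein n c`** (`a = p^J − 1`,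
`(1+T)^{p^J − 1} = (1+T)^{−1}`): with `T|_𝔖 := conj_γ − 1`, `ψ(γ) = 1 + T`, `cor ∘ unit` intertwines `T` with
`ι(T) = (1+T)^{−1} − 1`. [cite: SerreGaloisCohomology1997, I §2.5 (b) and Exercise 1] [cite: Washington1997, §13.1–§13.2] -/
theorem coresEisenstein_conjMap_of_layerIndex_eq_one {g : absoluteGaloisGroup K}
    (hg : κ.layerIndex (eisensteinLevel (p := p) hm k) g = 1)
    (c : continuousCohomology 1 (subgroupRep ρ.toTopRep N)) :
    κ.coresEisenstein ρ hm k N hN hNo (conjMap ρ.toTopRep N g 1 c) =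
      galoisCohomology.map
        (κ.eisensteinTwistSMulHom ρ hm k
          (IwasawaAlgebra.EisensteinCoeff.onePlusT p m k ^ (p ^ eisensteinLevel (p := p) hm k - 1))) 1
        (κ.coresEisenstein ρ hm k N hN hNo c) := by
  refine κ.coresEisenstein_conjMap ρ hm k N hN hNo g ?_ c
  rw [hg, Nat.cast_sub (Nat.one_le_pow _ _ hp.out.pos), ZMod.natCast_self, zero_sub, Nat.cast_one]

/-- **A topological generator `γ` of `κ` acts as `(1+T)^{p^J − 1} • = (1+T)^{−1} •`** after `coresEisenstein`.
[cite: Washington1997, §13.1–§13.2] [cite: SerreGaloisCohomology1997, I §2.5 (b) and Exercise 1] -/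
theorem coresEisenstein_conjMap_of_isTopGenerator {γ : absoluteGaloisGroup K} (hγ : κ.IsTopGenerator γ)
    (c : continuousCohomology 1 (subgroupRep ρ.toTopRep N)) :
    κ.coresEisenstein ρ hm k N hN hNo (conjMap ρ.toTopRep N γ 1 c) =
      galoisCohomology.map
        (κ.eisensteinTwistSMulHom ρ hm k
          (IwasawaAlgebra.EisensteinCoeff.onePlusT p m k ^ (p ^ eisensteinLevel (p := p) hm k - 1))) 1
        (κ.coresEisenstein ρ hm k N hN hNo c) :=
  κ.coresEisenstein_conjMap_of_layerIndex_eq_one ρ hm k N hN hNo (κ.layerIndex_eq_one_of_isTopGenerator _ hγ) c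

/-- **The inverse `γ⁻¹` of a topological generator acts as `(1+T) •`** after `coresEisenstein`.
[cite: Washington1997, §13.1–§13.2] [cite: SerreGaloisCohomology1997, I §2.5 (b) and Exercise 1] -/
theorem coresEisenstein_conjMap_inv_of_isTopGenerator {γ : absoluteGaloisGroup K} (hγ : κ.IsTopGenerator γ)
    (c : continuousCohomology 1 (subgroupRep ρ.toTopRep N)) :
    κ.coresEisenstein ρ hm k N hN hNo (conjMap ρ.toTopRep N γ⁻¹ 1 c) =
      galoisCohomology.map
        (κ.eisensteinTwistSMulHom ρ hm k (IwasawaAlgebra.EisensteinCoeff.onePlusT p m k)) 1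
        (κ.coresEisenstein ρ hm k N hN hNo c) :=
  κ.coresEisenstein_conjMap_of_layerIndex_eq_neg_one ρ hm k N hN hNo
    (by rw [layerIndex_inv, κ.layerIndex_eq_one_of_isTopGenerator _ hγ]) c

end ConjDictionary

/-! ## §4 Transitivity in the subgroup (the level `n`) -/

section Level

/-- **`coresEisenstein N' = coresEisenstein N ∘ cor_{N' → N}`** for open subgroups `N' ≤ N ≤ Γ_J` of finite index
(intended `N = Γ_n`, `N' = Γ_{n'}`, `J ≤ n ≤ n'`): transitivity of the transfer (`cores_coresLe_eq_cores`) + its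
naturality in the coefficients (`cohomologyMap_coresLe`), the unit map being the same on both subgroups. So
`coresEisenstein Γ_n x_n` is independent of `n ≥ J` on a corestriction-compatible family `(x_n)_n` (e.g. an
element of `𝔖 = lim← H¹(K_n, ·)`). Finiteness structures are instance binders.
[cite: SerreGaloisCohomology1997, I §2.4 and §2.5 (b)] [cite: Howard2004HeegnerKolyvagin, §2.2 (𝔖 = lim← H¹(K_n, T))] -/
theorem coresEisenstein_coresLe {N N' : Subgroup (absoluteGaloisGroup K)}
    (hN : N ≤ κ.layerSubgroup (eisensteinLevel (p := p) hm k)) (hN'N : N' ≤ N)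
    (hNo : IsOpen (N : Set (absoluteGaloisGroup K))) (hN'o : IsOpen (N' : Set (absoluteGaloisGroup K)))
    [Fintype (absoluteGaloisGroup K ⧸ N)] [Fintype (absoluteGaloisGroup K ⧸ N')] [Fintype (N ⧸ N'.subgroupOf N)]
    (c : continuousCohomology 1 (subgroupRep ρ.toTopRep N')) :
    κ.coresEisenstein ρ hm k N' (hN'N.trans hN) hN'o c =
      κ.coresEisenstein ρ hm k N hN hNo (coresLe ρ.toTopRep hN'N hN'o c) := by
  -- RHS: naturality of `coresLe` in the coefficients, then transitivity of the transfer
  have hR : κ.coresEisenstein ρ hm k N hN hNo (coresLe ρ.toTopRep hN'N hN'o c) =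
      cores (κ.eisensteinTwist ρ hm k).toTopRep N' hN'o
        (cohomologyMap (restrictHomOfLe (X := ρ.toTopRep) (Y := (κ.eisensteinTwist ρ hm k).toTopRep)
          (H := N') (H' := N) hN'N (κ.eisensteinUnitCoeffHom ρ hm k N hN)) 1 c) := by
    rw [coresEisenstein_apply, cohomologyMap_coresLe, cores_coresLe_eq_cores]
  rw [hR, coresEisenstein_apply]
  obtain ⟨φ, rfl⟩ := oneCocycleClass_surjective _ c
  rw [cohomologyMap_oneCocycleClass, cohomologyMap_oneCocycleClass]
  refine congrArg _ (congrArg _ (Subtype.ext (ContinuousMap.ext fun x ↦ ?_)))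
  rw [pullback_id_resIdHom_apply, pullback_id_resIdHom_apply, restrictHomOfLe_hom_apply,
    eisensteinUnitCoeffHom_hom_apply, eisensteinUnitCoeffHom_hom_apply]

end Level

/-! ## §5 Naturality in `(k, M)`: the reduction maps commute with `coresEisenstein` -/

section Reduce

variable {M' : Type u} [AddCommGroup M'] [TopologicalSpace M'] [DiscreteTopology M']
  {ρ} {ρ' : DiscreteGaloisModule K M'} {k} {k' : ℕ} (hkk' : k ≤ k')

/-- **`H¹(eisensteinTwistReduce f) ∘ coresEisenstein_{k'} = coresEisenstein_k ∘ H¹(N, f)`** (`k ≤ k'`,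
`f : M → M'` a morphism of discrete Galois modules, `N` below both `Γ_{J(k')}` and `Γ_{J(k)}`): `cor` is natural in
the coefficients (`cohomologyMap_cores`) and `reduce (1 ⊗ a) = 1 ⊗ f a`. For `f = (p^{k'−k}) : E[p^{k'}] → E[p^k]`
these are the transition maps of `H = lim←_k H¹(K, T_𝔮/p^k T_𝔮)` and of `S_p(E/K_n) = lim←_k H¹(K_n, E[p^k])`.
[cite: Howard2004HeegnerKolyvagin, §2.2, Def. 2.2.3 and Lemma 2.2.7] [cite: SerreGaloisCohomology1997, I §2.4] -/
theorem map_eisensteinTwistReduce_coresEisenstein (f : ρ.toContRepresentation →ⁱL ρ'.toContRepresentation)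
    (N : Subgroup (absoluteGaloisGroup K)) (hN' : N ≤ κ.layerSubgroup (eisensteinLevel (p := p) hm k'))
    (hN : N ≤ κ.layerSubgroup (eisensteinLevel (p := p) hm k)) (hNo : IsOpen (N : Set (absoluteGaloisGroup K)))
    [Fintype (absoluteGaloisGroup K ⧸ N)] (c : continuousCohomology 1 (subgroupRep ρ.toTopRep N)) :
    galoisCohomology.map (κ.eisensteinTwistReduce hm hkk' f) 1 (κ.coresEisenstein ρ hm k' N hN' hNo c) =
      κ.coresEisenstein ρ' hm k N hN hNo
        (cohomologyMap (subgroupRepHom (TopRep.ofHom ⟨f.toContinuousLinearMap, f.isIntertwining'⟩) N) 1 c) := by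
  obtain ⟨φ, rfl⟩ := oneCocycleClass_surjective _ c
  set R : (κ.eisensteinTwist ρ hm k').toTopRep ⟶ (κ.eisensteinTwist ρ' hm k).toTopRep :=
    TopRep.ofHom ⟨(κ.eisensteinTwistReduce hm hkk' f).toContinuousLinearMap,
      (κ.eisensteinTwistReduce hm hkk' f).isIntertwining'⟩ with hR
  change cohomologyMap R 1 (cores _ _ _
      (cohomologyMap (κ.eisensteinUnitCoeffHom ρ hm k' N hN') 1 (oneCocycleClass _ φ))) =
    cores _ _ _ (cohomologyMap (κ.eisensteinUnitCoeffHom ρ' hm k N hN) 1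
      (cohomologyMap _ 1 (oneCocycleClass _ φ)))
  -- the coefficient maps agree on cocycles: `reduce (1 ⊗ φ(x)) = 1 ⊗ f (φ x)`
  have hinner : cohomologyMap (subgroupRepHom R N) 1
        (cohomologyMap (κ.eisensteinUnitCoeffHom ρ hm k' N hN') 1 (oneCocycleClass _ φ)) =
      cohomologyMap (κ.eisensteinUnitCoeffHom ρ' hm k N hN) 1
        (cohomologyMap (subgroupRepHom (TopRep.ofHom ⟨f.toContinuousLinearMap, f.isIntertwining'⟩) N) 1
          (oneCocycleClass _ φ)) := by
    rw [cohomologyMap_oneCocycleClass, cohomologyMap_oneCocycleClass, cohomologyMap_oneCocycleClass,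
      cohomologyMap_oneCocycleClass]
    refine congrArg _ (Subtype.ext (ContinuousMap.ext fun x ↦ ?_))
    rw [pullback_id_resIdHom_apply, pullback_id_resIdHom_apply, pullback_id_resIdHom_apply,
      pullback_id_resIdHom_apply, subgroupRepHom_hom_apply, eisensteinUnitCoeffHom_hom_apply,
      eisensteinUnitCoeffHom_hom_apply, subgroupRepHom_hom_apply]
    change κ.eisensteinTwistReduce hm hkk' f (eisensteinUnitCoeff p m k' (φ.1 x)) =
      eisensteinUnitCoeff p m k (f (φ.1 x))
    rw [eisensteinUnitCoeff_apply, eisensteinUnitCoeff_apply, eisensteinTwistReduce_tmul, map_one]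
  rw [cohomologyMap_cores, hinner]

end Reduce

end ZpExtension

end Literature.NumberTheory.EllipticCurves

end
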